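import Summits.QuantumFields.BalabanUV.Beta.NVertexLamK1Prime
import Summits.QuantumFields.BalabanUV.Beta.CompositeCorrectorFormsGeneric

/-!
# `BalabanUV.Beta.NVertexColumnK1RowChartGeneric` — row D1 ∕ (C1): PART 18 `NVertexLamStraightPullback`, PART 21 `NVertexColumnK1Row`, PART 22 §2–§3 and PART 28 §2 AT A GENERIC CHART `A`
# — the tree's statements VERBATIM under `AN R j ↦ A` with the record's chart lemmas replaced by DISPLAYED LETTERS: `hA : ∃ δ C, 0 < δ ∧ 0 ≤ C ∧ Decays A C δ` (spread),
# `hE : ∀ μ y, curvAdj (curv (colH A (Lc^(j+1)) μ y)) = curvAdj (curv (Hcol μ y))` (column curvature = the (K1′) content) and `hmm` (the mm block = `wΦ`); ROAD-FREE, def-free.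
# §1 `Λ′_A` bounded coarse co-closed covector; §2 the transported responses in closed form; §3 the (K1)∕(K1′) rows at `A`; §4 (II) CONTROLS at `A := AN R j` = the tree's PART 22∕28.

WHAT ([folklore] bookkeeping; no `def`; nothing cited; 0 sorry).  The L-chart INSTANCES (letters as theorems at `ANs R Ψ̂ˢ j`) are `NVertexColumnK1RowSym`'s.

HONEST FRAMING (cell charter, verbatim): «discharging BetaPertH makes Balaban's UV stability UNCONDITIONAL — a real
constructive-QFT result; it is NOT the continuum limit and NOT the Clay problem.»
HONEST DEPENDENCY: continuum YM on T⁴ ⇐ BetaPertH ∧ nine spine estimates (0/9 proved); BetaPertH ⇐ (D1) ∧ (D4) ∧ CAP+tail;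
G-an2-4 gates asym, D1 and NE2/3/4.
ABSOLUTE RULE (cell, verbatim): «No internally-minted statement may enter as a cited fact. Every hypothesis is either kernel-proved in this
package or a verbatim quotation of a PUBLISHED theorem with page reference. The manuscript(s) under audit are NOT citable for their own
disputed steps — they are the thing under adjudication; programme-internal (2001/route/tribunal) claims are never citable.»
Row D1 ∕ (C1) OWNER an2 (b2b-balaban-beta-an2) gen 92, 2026-08-31.  No existing file touched.  STAGED ONLY (FILING PLAN FP-L F-L7a); NOT proposed before the operator∕director line.
NOTHING of Bałaban's asserted, valued or discharged; 0 estimates; 0∕4 row-D1 binders; ROOT M‴ p325680 ∕ P5c ∕ D6 untouched; NOT (C1), NOT (T-ID), NOT D1, NEVER «G-an2-4 closed», NOT BetaPertH, NOT continuum, NOT Clay.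
-/

namespace Summit.QuantumFields.BalabanUV.Beta.NVertexColumnK1RowChartGeneric

open Finset
open Literature.MathematicalPhysics.QuantumFieldTheory
open Literature.MathematicalPhysics.QuantumFieldTheory.Balaban1983to89
open Literature.MathematicalPhysics.QuantumFieldTheory.Balaban1983to89.Beta
open B12Sec2to5 (l1 l1_nonneg summable_exp_neg_l1)
open AffineAveraging (Form1 Site box toSite curv curvAdj codiff₁)
open AveragingHessianKernels (Bond Near ell straightCount)
open ExpKernelCalculus (MKer Decays comp)
open OneStepResolventKernel (Fib KInv KInv_inr_inr_coarse decays_KInv)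
open OneStepKernelFamily (colH)
open KernelSpecInstance (wΦ)
open ResolventComposition (Hcol HΦcol HΦcol_apply Hcol_bdd_summable)
open BalabanStepJets (lamCoeffOf)
open KKTFluctuationEnergy (lip1 summable_of_exp_bound summable_mul_of_bdd abs_le_of_exp_bound)
open Summit.QuantumFields.BalabanUV.Beta.TameKernelCalculus (Spr trK Spr.trK)
open Summit.QuantumFields.BalabanUV.Beta.ChartConjugationRelative (spr_comp)
open Summit.QuantumFields.BalabanUV.Beta.AxialDressingRooted (coProjBmW coDressKBmAt coDressKBmAt_inr_inr spr_coDressKBmAt one_le_of_neZero)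
open Summit.QuantumFields.BalabanUV.Beta.SymAveragingHessianCounts (symLinKerAt symLinKerAt_eq_zero)
open Summit.QuantumFields.BalabanUV.Beta.CompositeVertexKernelRec (compLinKer)
open Summit.QuantumFields.BalabanUV.Beta.NVertexLamWeightLadder (compLinKer_succ_bottom lamR_succ)
open Summit.QuantumFields.BalabanUV.Beta.CompositeCorrectorForms (corrPsi curv_corrPsi)
open Summit.QuantumFields.BalabanUV.Beta.CompositeAveragingCoarseExactGeneric (corrPsiSym curv_corrPsiSym)
open Summit.QuantumFields.BalabanUV.Beta.CompositeCorrectorKernel (psiK)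
open Summit.QuantumFields.BalabanUV.Beta.CompositeOneShotJetData (Roots AN AN_eq)
open Summit.QuantumFields.BalabanUV.Beta.NVertexSectors (decays_AN)
open Summit.QuantumFields.BalabanUV.Beta.StraightColumnK1Row (lamCovector_eq_neg_lip1_curvAdj lamCovector_Hcol K1_row_straight_column_straight codiff₁_lamCovector)
open Summit.QuantumFields.BalabanUV.Beta.BlockMeanChartK1Row (coProjBmW_Hcol_eq_colH_coDressKBmAt curvAdj_curv_coProjBmW)
open Summit.QuantumFields.BalabanUV.Beta.CoclosedCovectorLinearRowsNear (summable_of_near straightCount_eq_zero_of_not_near)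
open Summit.QuantumFields.BalabanUV.Beta.GAN24.TaylorLamBracket (exists_abs_lamCoeffOf_KInv_le)
open Summit.QuantumFields.BalabanUV.Beta.CoclosedCovectorCompositeRows (tsum_sum_mul_compLinKer_symLinKerAt_of_bounded)
open Summit.QuantumFields.BalabanUV.Beta.NVertexLamCorePeriodised (slot_mem_nearBox_of_near)
open Summit.QuantumFields.BalabanUV.Beta.NVertexColumnK1Row (curvAdj_curv_colH_AN K1_row_composite_column_sym LamN_eq_neg_HΦcol)
open Summit.QuantumFields.BalabanUV.Beta.NVertexLamK1Prime (AN_inr_inr_smul LamN_eq_neg_AN_inr_inr)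

noncomputable section

variable {Lc : ℕ} [NeZero Lc] (R : Roots Lc) (j : ℕ)

/-! ## §1 At a GENERIC chart `A`: `Λ′_A μ y` is a bounded coarse co-closed covector (PART 21 §1 verbatim, `AN R j ↦ A`, `decays_AN R j ↦ hA`) -/

section Letters

variable (A : MKer (3 + 1) (Fib 3))

omit [NeZero Lc] in
/-- [folklore] the chart's column sourced at `(μ, L•y)` decays from its source. -/
theorem abs_colA_le {C δ : ℝ} (hK : Decays A C δ) (μ κ' : Fin (3 + 1)) (y u : Site (3 + 1)) :
    |A u (((Lc ^ (j + 1) : ℕ) : ℤ) • y) (Sum.inl κ') (Sum.inr μ)| ≤ C * Real.exp (-δ * l1 (u - ((Lc ^ (j + 1) : ℕ) : ℤ) • y)) :=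
  hK _ _ _ _

variable (hA : ∃ δ C : ℝ, 0 < δ ∧ 0 ≤ C ∧ Decays A C δ)
include hA

omit [NeZero Lc] in
/-- [folklore] … hence the column is summable in its fine site. -/
theorem summable_colA (μ κ' : Fin (3 + 1)) (y : Site (3 + 1)) :
    Summable fun u : Site (3 + 1) => A u (((Lc ^ (j + 1) : ℕ) : ℤ) • y) (Sum.inl κ') (Sum.inr μ) := by
  obtain ⟨δ, C, hδ, -, hK⟩ := hA
  exact summable_of_exp_bound hδ _ (abs_colA_le j A hK μ κ' y)

/-- [folklore] **THE EXCHANGE**: `Λ′_A μ y ν w = Σ'_u Σ_{κ′} lamCoeffOf (KInv L) L ν w κ′ u · A u (L•y) (inl κ′) (inr μ)`. -/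
theorem LamA_eq_tsum_sum (μ ν : Fin (3 + 1)) (y w : Site (3 + 1)) :
    (∑ κ' : Fin (3 + 1), ∑' u : Site (3 + 1),
        A u (((Lc ^ (j + 1) : ℕ) : ℤ) • y) (Sum.inl κ') (Sum.inr μ) * lamCoeffOf (KInv (N := Lc ^ (j + 1)) (d := 3)) (Lc ^ (j + 1)) ν w κ' u)
      = ∑' u : Site (3 + 1), ∑ κ' : Fin (3 + 1),
          lamCoeffOf (KInv (N := Lc ^ (j + 1)) (d := 3)) (Lc ^ (j + 1)) ν w κ' u * A u (((Lc ^ (j + 1) : ℕ) : ℤ) • y) (Sum.inl κ') (Sum.inr μ) := by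
  obtain ⟨CΛ, -, hΛ⟩ := exists_abs_lamCoeffOf_KInv_le (N := Lc ^ (j + 1)) (d := 3)
  rw [Summable.tsum_finsetSum fun κ' _ => summable_mul_of_bdd (fun u => hΛ ν w κ' u) (summable_colA j A hA μ κ' y)]
  exact Finset.sum_congr rfl fun κ' _ => tsum_congr fun u => mul_comm _ _

/-- [folklore] **`Λ′_A` IS COARSE CO-CLOSED**. -/
theorem codiff₁_LamA (μ : Fin (3 + 1)) (y : Site (3 + 1)) :
    codiff₁ (fun ν w => ∑ κ' : Fin (3 + 1), ∑' u : Site (3 + 1),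
        A u (((Lc ^ (j + 1) : ℕ) : ℤ) • y) (Sum.inl κ') (Sum.inr μ) * lamCoeffOf (KInv (N := Lc ^ (j + 1)) (d := 3)) (Lc ^ (j + 1)) ν w κ' u) = 0 := by
  obtain ⟨δ, C, hδ, hC, hK⟩ := hA
  have h := codiff₁_lamCovector (N := Lc ^ (j + 1)) (d := 3) (h := fun κ' u => A u (((Lc ^ (j + 1) : ℕ) : ℤ) • y) (Sum.inl κ') (Sum.inr μ))
    (M := C) (fun κ' u => abs_le_of_exp_bound hδ hC _ (abs_colA_le j A hK μ κ' y) u) (fun κ' => summable_colA j A ⟨δ, C, hδ, hC, hK⟩ μ κ' y)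
  rw [show (fun ν w => ∑ κ' : Fin (3 + 1), ∑' u : Site (3 + 1),
        A u (((Lc ^ (j + 1) : ℕ) : ℤ) • y) (Sum.inl κ') (Sum.inr μ) * lamCoeffOf (KInv (N := Lc ^ (j + 1)) (d := 3)) (Lc ^ (j + 1)) ν w κ' u)
      = fun ν w => ∑' u : Site (3 + 1), ∑ κ' : Fin (3 + 1),
          lamCoeffOf (KInv (N := Lc ^ (j + 1)) (d := 3)) (Lc ^ (j + 1)) ν w κ' u * A u (((Lc ^ (j + 1) : ℕ) : ℤ) • y) (Sum.inl κ') (Sum.inr μ) from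
    funext fun ν => funext fun w => LamA_eq_tsum_sum j A ⟨δ, C, hδ, hC, hK⟩ μ ν y w]
  exact h

omit hA in
/-- [folklore] **`Λ′_A` IS BOUNDED** uniformly in the source label and the slot. -/
theorem abs_LamA_le {C δ CΛ : ℝ} (hK : Decays A C δ) (hδ : 0 < δ)
    (hΛ : ∀ (ν : Fin (3 + 1)) (w : Site (3 + 1)) (κ' : Fin (3 + 1)) (u : Site (3 + 1)),
      |lamCoeffOf (KInv (N := Lc ^ (j + 1)) (d := 3)) (Lc ^ (j + 1)) ν w κ' u| ≤ CΛ)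
    (μ ν : Fin (3 + 1)) (y w : Site (3 + 1)) :
    |∑ κ' : Fin (3 + 1), ∑' u : Site (3 + 1),
        A u (((Lc ^ (j + 1) : ℕ) : ℤ) • y) (Sum.inl κ') (Sum.inr μ) * lamCoeffOf (KInv (N := Lc ^ (j + 1)) (d := 3)) (Lc ^ (j + 1)) ν w κ' u|
      ≤ ((3 + 1 : ℕ) : ℝ) * (CΛ * (C * ∑' v : Site (3 + 1), Real.exp (-δ * l1 v))) := by
  have hcol : ∀ κ' : Fin (3 + 1), Summable fun u : Site (3 + 1) => A u (((Lc ^ (j + 1) : ℕ) : ℤ) • y) (Sum.inl κ') (Sum.inr μ) :=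
    fun κ' => summable_of_exp_bound hδ _ (abs_colA_le j A hK μ κ' y)
  have hZ : ∀ κ' : Fin (3 + 1), ∑' u : Site (3 + 1), |A u (((Lc ^ (j + 1) : ℕ) : ℤ) • y) (Sum.inl κ') (Sum.inr μ)|
      ≤ C * ∑' v : Site (3 + 1), Real.exp (-δ * l1 v) := by
    intro κ'
    have hs : Summable fun u : Site (3 + 1) => Real.exp (-δ * l1 (u - ((Lc ^ (j + 1) : ℕ) : ℤ) • y)) :=
      KKTFluctuationEnergy.summable_shift_sub (summable_exp_neg_l1 hδ (3 + 1)) _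
    refine (Summable.tsum_le_tsum (abs_colA_le j A hK μ κ' y) (hcol κ').abs (hs.mul_left C)).trans ?_
    rw [tsum_mul_left, KKTFluctuationEnergy.tsum_shift_sub (fun v : Site (3 + 1) => Real.exp (-δ * l1 v))]
  have hterm : ∀ κ' : Fin (3 + 1), |∑' u : Site (3 + 1),
      A u (((Lc ^ (j + 1) : ℕ) : ℤ) • y) (Sum.inl κ') (Sum.inr μ) * lamCoeffOf (KInv (N := Lc ^ (j + 1)) (d := 3)) (Lc ^ (j + 1)) ν w κ' u|
        ≤ CΛ * (C * ∑' v : Site (3 + 1), Real.exp (-δ * l1 v)) := by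
    intro κ'
    have hCΛ : 0 ≤ CΛ := (abs_nonneg _).trans (hΛ ν w κ' 0)
    have h1 := BalabanCompositeJets.abs_tsum_mul_le (H := fun u => lamCoeffOf (KInv (N := Lc ^ (j + 1)) (d := 3)) (Lc ^ (j + 1)) ν w κ' u)
      (fun u => hΛ ν w κ' u) (hcol κ')
    rw [show (fun u : Site (3 + 1) => A u (((Lc ^ (j + 1) : ℕ) : ℤ) • y) (Sum.inl κ') (Sum.inr μ)
        * lamCoeffOf (KInv (N := Lc ^ (j + 1)) (d := 3)) (Lc ^ (j + 1)) ν w κ' u)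
      = fun u => lamCoeffOf (KInv (N := Lc ^ (j + 1)) (d := 3)) (Lc ^ (j + 1)) ν w κ' u * A u (((Lc ^ (j + 1) : ℕ) : ℤ) • y) (Sum.inl κ') (Sum.inr μ)
      from funext fun u => mul_comm _ _]
    exact h1.trans (mul_le_mul_of_nonneg_left (hZ κ') hCΛ)
  refine (abs_sum_le_sum_abs _ _).trans ((sum_le_sum fun κ' _ => hterm κ').trans ?_)
  rw [sum_const, card_univ, Fintype.card_fin, nsmul_eq_mul]

/-- [folklore] **`exists_abs_LamA_le`**. -/
theorem exists_abs_LamA_le : ∃ M : ℝ, ∀ (μ ν : Fin (3 + 1)) (y w : Site (3 + 1)),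
    |∑ κ' : Fin (3 + 1), ∑' u : Site (3 + 1),
        A u (((Lc ^ (j + 1) : ℕ) : ℤ) • y) (Sum.inl κ') (Sum.inr μ) * lamCoeffOf (KInv (N := Lc ^ (j + 1)) (d := 3)) (Lc ^ (j + 1)) ν w κ' u| ≤ M := by
  obtain ⟨δ, C, hδ, -, hK⟩ := hA
  obtain ⟨CΛ, -, hΛ⟩ := exists_abs_lamCoeffOf_KInv_le (N := Lc ^ (j + 1)) (d := 3)
  exact ⟨_, fun μ ν y w => abs_LamA_le j A hK hδ hΛ μ ν y w⟩

end Letters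

/-! ## §2 At a GENERIC chart: the transported responses in closed form (PART 18 `lamR_succ` — `A`-free — and PART 21 §2 verbatim) -/

section Closed

variable (A : MKer (3 + 1) (Fib 3))

/-- [folklore] **`lamRA_succ` — ONE STOREY DOWN = ONE BRICK**, at ANY chart (PART 18 `lamR_succ`'s proof uses nothing of `AN`). -/
theorem lamRA_succ (m : ℕ) (μ κ : Fin (3 + 1)) (y s : Site (3 + 1)) :
    (∑ ν : Fin (3 + 1), ∑' w : Site (3 + 1),
        (∑ κ' : Fin (3 + 1), ∑' u : Site (3 + 1),
            A u (((Lc ^ (j + 1) : ℕ) : ℤ) • y) (Sum.inl κ') (Sum.inr μ) * lamCoeffOf (KInv (N := Lc ^ (j + 1)) (d := 3)) (Lc ^ (j + 1)) ν w κ' u)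
          * compLinKer (fun _ => symLinKerAt (toSite R.r) Lc) Lc (m + 1) (κ, s) (ν, w))
      = ∑ κ₁ : Fin (3 + 1), ∑' s₁ : Site (3 + 1),
          (∑ ν : Fin (3 + 1), ∑' w : Site (3 + 1),
              (∑ κ' : Fin (3 + 1), ∑' u : Site (3 + 1),
                  A u (((Lc ^ (j + 1) : ℕ) : ℤ) • y) (Sum.inl κ') (Sum.inr μ) * lamCoeffOf (KInv (N := Lc ^ (j + 1)) (d := 3)) (Lc ^ (j + 1)) ν w κ' u)
                * compLinKer (fun _ => symLinKerAt (toSite R.r) Lc) Lc m (κ₁, s₁) (ν, w))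
            * symLinKerAt (toSite R.r) Lc κ₁ s₁ (κ, s) := by
  have hL : 0 < Lc := Nat.pos_of_ne_zero (NeZero.ne Lc)
  set NB := Fintype.piFinset (fun i => Finset.Icc ((s i - ((2 * Lc - 1 : ℕ) : ℤ)) / (Lc : ℤ)) (s i / (Lc : ℤ))) with hNB
  have h0 : ∀ (κ₁ : Fin (3 + 1)) (s₁ : Site (3 + 1)), s₁ ∉ NB → symLinKerAt (toSite R.r) Lc κ₁ s₁ (κ, s) = 0 :=
    fun κ₁ s₁ hs₁ => symLinKerAt_eq_zero R.hr (f := (κ, s)) fun h => hs₁ (slot_mem_nearBox_of_near hL h)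
  have hpeel : ∀ (ν : Fin (3 + 1)) (w : Site (3 + 1)),
      compLinKer (fun _ => symLinKerAt (toSite R.r) Lc) Lc (m + 1) (κ, s) (ν, w)
        = ∑ κ₁ : Fin (3 + 1), ∑ s₁ ∈ NB, compLinKer (fun _ => symLinKerAt (toSite R.r) Lc) Lc m (κ₁, s₁) (ν, w) * symLinKerAt (toSite R.r) Lc κ₁ s₁ (κ, s) :=
    fun ν w => by
      rw [compLinKer_succ_bottom (ℓ := fun _ => symLinKerAt (toSite R.r) Lc) (L := Lc) (fun μ' y' f h => symLinKerAt_eq_zero R.hr h) m (κ, s) (ν, w)]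
      exact Finset.sum_congr rfl fun κ₁ _ => tsum_eq_sum fun s₁ hs₁ => by rw [h0 κ₁ s₁ hs₁, mul_zero]
  have hw : ∀ (ν κ₁ : Fin (3 + 1)) (s₁ : Site (3 + 1)), Summable fun w : Site (3 + 1) =>
      (∑ κ' : Fin (3 + 1), ∑' u : Site (3 + 1),
          A u (((Lc ^ (j + 1) : ℕ) : ℤ) • y) (Sum.inl κ') (Sum.inr μ) * lamCoeffOf (KInv (N := Lc ^ (j + 1)) (d := 3)) (Lc ^ (j + 1)) ν w κ' u)
        * (compLinKer (fun _ => symLinKerAt (toSite R.r) Lc) Lc m (κ₁, s₁) (ν, w) * symLinKerAt (toSite R.r) Lc κ₁ s₁ (κ, s)) := fun ν κ₁ s₁ =>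
    ((CompositeVertexKernelLiftKernel.summable_mul_compLinKer_top (ℓ := fun _ => symLinKerAt (toSite R.r) Lc) hL 0 m
      (fun w' => ∑ κ' : Fin (3 + 1), ∑' u : Site (3 + 1),
          A u (((Lc ^ (j + 1) : ℕ) : ℤ) • y) (Sum.inl κ') (Sum.inr μ) * lamCoeffOf (KInv (N := Lc ^ (j + 1)) (d := 3)) (Lc ^ (j + 1)) ν w' κ' u)
      κ₁ ν s₁).mul_right (symLinKerAt (toSite R.r) Lc κ₁ s₁ (κ, s))).congr fun w => by ring
  simp_rw [hpeel, Finset.mul_sum]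
  rw [Finset.sum_congr rfl fun ν _ =>
      Summable.tsum_finsetSum (s := (Finset.univ : Finset (Fin (3 + 1)))) fun κ₁ _ => summable_sum (s := NB) fun s₁ _ => hw ν κ₁ s₁]
  rw [Finset.sum_congr rfl fun ν _ => Finset.sum_congr rfl fun κ₁ _ => Summable.tsum_finsetSum (s := NB) fun s₁ _ => hw ν κ₁ s₁]
  rw [Finset.sum_comm]
  refine Finset.sum_congr rfl fun κ₁ _ => ?_
  rw [Finset.sum_comm, tsum_eq_sum (s := NB) fun s₁ hs₁ => by rw [h0 κ₁ s₁ hs₁, mul_zero]]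
  refine Finset.sum_congr rfl fun s₁ _ => ?_
  rw [Finset.sum_mul]
  refine Finset.sum_congr rfl fun ν _ => ?_
  rw [← tsum_mul_right]
  exact tsum_congr fun w => by ring

variable (hA : ∃ δ C : ℝ, 0 < δ ∧ 0 ≤ C ∧ Decays A C δ)
include hA

/-- [folklore] **`lamRA_eq_straightCount` — THE TRANSPORTED RESPONSE IS A STRAIGHT PULLBACK** at any decaying chart. -/
theorem lamRA_eq_straightCount (m : ℕ) (μ κ : Fin (3 + 1)) (y s : Site (3 + 1)) :
    (∑ ν : Fin (3 + 1), ∑' w : Site (3 + 1),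
        (∑ κ' : Fin (3 + 1), ∑' u : Site (3 + 1),
            A u (((Lc ^ (j + 1) : ℕ) : ℤ) • y) (Sum.inl κ') (Sum.inr μ) * lamCoeffOf (KInv (N := Lc ^ (j + 1)) (d := 3)) (Lc ^ (j + 1)) ν w κ' u)
          * compLinKer (fun _ => symLinKerAt (toSite R.r) Lc) Lc m (κ, s) (ν, w))
      = (((Lc : ℝ) ^ (3 + 1))⁻¹) ^ m * ∑ ν : Fin (3 + 1), ∑' w : Site (3 + 1),
          (∑ κ' : Fin (3 + 1), ∑' u : Site (3 + 1),
              A u (((Lc ^ (j + 1) : ℕ) : ℤ) • y) (Sum.inl κ') (Sum.inr μ) * lamCoeffOf (KInv (N := Lc ^ (j + 1)) (d := 3)) (Lc ^ (j + 1)) ν w κ' u)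
            * (straightCount (Lc ^ m) ν w (κ, s) : ℝ) := by
  obtain ⟨M, hM⟩ := exists_abs_LamA_le (Lc := Lc) j A hA
  exact tsum_sum_mul_compLinKer_symLinKerAt_of_bounded (d := 3) (fun ν w => hM μ ν y w) (codiff₁_LamA j A hA μ y)
    (Nat.pos_of_ne_zero (NeZero.ne Lc)) (fun _ => R.hr) m (κ, s)

/-- [folklore] **THE (K1)-ROW SHAPE** at any decaying chart: one more (0.4)-sym brick = the depth-`(m+1)` straight pullback. -/
theorem tsum_lamRA_mul_symLinKerAt_eq_straightCount (m : ℕ) (μ κ : Fin (3 + 1)) (y s : Site (3 + 1)) :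
    (∑ κ₁ : Fin (3 + 1), ∑' s₁ : Site (3 + 1),
        (∑ ν : Fin (3 + 1), ∑' w : Site (3 + 1),
            (∑ κ' : Fin (3 + 1), ∑' u : Site (3 + 1),
                A u (((Lc ^ (j + 1) : ℕ) : ℤ) • y) (Sum.inl κ') (Sum.inr μ) * lamCoeffOf (KInv (N := Lc ^ (j + 1)) (d := 3)) (Lc ^ (j + 1)) ν w κ' u)
              * compLinKer (fun _ => symLinKerAt (toSite R.r) Lc) Lc m (κ₁, s₁) (ν, w))
          * symLinKerAt (toSite R.r) Lc κ₁ s₁ (κ, s))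
      = (((Lc : ℝ) ^ (3 + 1))⁻¹) ^ (m + 1) * ∑ ν : Fin (3 + 1), ∑' w : Site (3 + 1),
          (∑ κ' : Fin (3 + 1), ∑' u : Site (3 + 1),
              A u (((Lc ^ (j + 1) : ℕ) : ℤ) • y) (Sum.inl κ') (Sum.inr μ) * lamCoeffOf (KInv (N := Lc ^ (j + 1)) (d := 3)) (Lc ^ (j + 1)) ν w κ' u)
            * (straightCount (Lc ^ (m + 1)) ν w (κ, s) : ℝ) := by
  rw [← lamRA_succ R j A m μ κ y s, lamRA_eq_straightCount R j A hA (m + 1) μ κ y s]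

end Closed

/-! ## §3 At a GENERIC chart with the FORM letters `hE` (Hessian image of the column = the straight column's) and `hmm` (mm block = `wΦ`): PART 22 §2–§3 and PART 28 §2 verbatim -/

section K1Generic

variable (A : MKer (3 + 1) (Fib 3)) (hA : ∃ δ C : ℝ, 0 < δ ∧ 0 ≤ C ∧ Decays A C δ)
  (hE : ∀ (μ : Fin (3 + 1)) (y : Site (3 + 1)), curvAdj (curv (colH A (Lc ^ (j + 1)) μ y)) = curvAdj (curv (Hcol (N := Lc ^ (j + 1)) μ y)))
include hA

omit [NeZero Lc] hA in
/-- [folklore] `rfl` bridge: `colH A L μ y κ′ u = A u (L•y) (inl κ′) (inr μ)`. -/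
theorem colH_A_apply (μ : Fin (3 + 1)) (y : Site (3 + 1)) (κ' : Fin (3 + 1)) (u : Site (3 + 1)) :
    colH A (Lc ^ (j + 1)) μ y κ' u = A u (((Lc ^ (j + 1) : ℕ) : ℤ) • y) (Sum.inl κ') (Sum.inr μ) := rfl

omit [NeZero Lc] in
/-- [folklore] the column is bounded. -/
theorem exists_abs_colH_A_le (μ : Fin (3 + 1)) (y : Site (3 + 1)) :
    ∃ C : ℝ, ∀ (κ' : Fin (3 + 1)) (u : Site (3 + 1)), |colH A (Lc ^ (j + 1)) μ y κ' u| ≤ C := by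
  obtain ⟨δ, C, hδ, hC, hK⟩ := hA
  exact ⟨C, fun κ' u => abs_le_of_exp_bound hδ hC _ (abs_colA_le j A hK μ κ' y) u⟩

omit [NeZero Lc] in
/-- [folklore] the column is summable in its fine site. -/
theorem summable_colH_A (μ : Fin (3 + 1)) (y : Site (3 + 1)) (κ' : Fin (3 + 1)) : Summable (colH A (Lc ^ (j + 1)) μ y κ') :=
  summable_colA j A hA μ κ' y

include hE

/-- [folklore] **THE `Λ′`-COVECTOR OF THE COLUMN IS THAT OF THE STRAIGHT COLUMN** (g60 `lamCovector_eq_neg_lip1_curvAdj` on both sides + `hE`). -/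
theorem lamCovector_colH_A_eq_Hcol (μ : Fin (3 + 1)) (y : Site (3 + 1)) (ν : Fin (3 + 1)) (w : Site (3 + 1)) :
    (∑' x : Site (3 + 1), ∑ κ' : Fin (3 + 1), lamCoeffOf (KInv (N := Lc ^ (j + 1)) (d := 3)) (Lc ^ (j + 1)) ν w κ' x * colH A (Lc ^ (j + 1)) μ y κ' x)
      = ∑' x : Site (3 + 1), ∑ κ' : Fin (3 + 1), lamCoeffOf (KInv (N := Lc ^ (j + 1)) (d := 3)) (Lc ^ (j + 1)) ν w κ' x * Hcol (N := Lc ^ (j + 1)) μ y κ' x := by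
  obtain ⟨C, hb⟩ := exists_abs_colH_A_le (Lc := Lc) j A hA μ y
  obtain ⟨C', -, hb', hs'⟩ := Hcol_bdd_summable (N := Lc ^ (j + 1)) (d := 3)
  rw [lamCovector_eq_neg_lip1_curvAdj hb (summable_colH_A j A hA μ y) ν w, hE,
    ← lamCovector_eq_neg_lip1_curvAdj (hb' μ y) (hs' μ y) ν w]

/-- [folklore] **`Λ′_A μ y ν w = −Φ^ℋ_L(ν, w; μ, y)`** at any chart with `hA`, `hE`. -/
theorem LamA_eq_neg_HΦcol (μ ν : Fin (3 + 1)) (y w : Site (3 + 1)) :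
    (∑ κ' : Fin (3 + 1), ∑' u : Site (3 + 1),
        A u (((Lc ^ (j + 1) : ℕ) : ℤ) • y) (Sum.inl κ') (Sum.inr μ) * lamCoeffOf (KInv (N := Lc ^ (j + 1)) (d := 3)) (Lc ^ (j + 1)) ν w κ' u)
      = -HΦcol (N := Lc ^ (j + 1)) μ y ν w := by
  rw [LamA_eq_tsum_sum j A hA μ ν y w, ← lamCovector_Hcol (N := Lc ^ (j + 1)) μ y ν w, ← lamCovector_colH_A_eq_Hcol j A hA hE μ y ν w]
  rfl

/-- [folklore] **(K1) FOR THE COLUMN, STRAIGHT ROWS**, at any chart with `hA`, `hE`. -/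
theorem K1_row_A_column_straight (μ : Fin (3 + 1)) (y : Site (3 + 1)) (f : Bond (3 + 1)) :
    curvAdj (curv (colH A (Lc ^ (j + 1)) μ y)) f.1 f.2
      = -∑' w : Site (3 + 1), ∑ ν : Fin (3 + 1),
          (∑ κ' : Fin (3 + 1), ∑' u : Site (3 + 1),
              A u (((Lc ^ (j + 1) : ℕ) : ℤ) • y) (Sum.inl κ') (Sum.inr μ) * lamCoeffOf (KInv (N := Lc ^ (j + 1)) (d := 3)) (Lc ^ (j + 1)) ν w κ' u)
            * (straightCount (Lc ^ (j + 1)) ν w f : ℝ) := by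
  rw [hE, K1_row_straight_column_straight (N := Lc ^ (j + 1)) μ y f]
  congr 1
  refine tsum_congr fun w => Finset.sum_congr rfl fun ν _ => ?_
  rw [← lamCovector_colH_A_eq_Hcol j A hA hE μ y ν w, LamA_eq_tsum_sum j A hA μ ν y w]
  rfl

omit hA hE in
/-- [folklore] order of summation of the straight pairing (finite support in `w` for each `ν`). -/
theorem tsum_sum_LamA_straightCount_comm (μ : Fin (3 + 1)) (y : Site (3 + 1)) (f : Bond (3 + 1)) :
    (∑' w : Site (3 + 1), ∑ ν : Fin (3 + 1),
        (∑ κ' : Fin (3 + 1), ∑' u : Site (3 + 1),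
            A u (((Lc ^ (j + 1) : ℕ) : ℤ) • y) (Sum.inl κ') (Sum.inr μ) * lamCoeffOf (KInv (N := Lc ^ (j + 1)) (d := 3)) (Lc ^ (j + 1)) ν w κ' u)
          * (straightCount (Lc ^ (j + 1)) ν w f : ℝ))
      = ∑ ν : Fin (3 + 1), ∑' w : Site (3 + 1),
          (∑ κ' : Fin (3 + 1), ∑' u : Site (3 + 1),
              A u (((Lc ^ (j + 1) : ℕ) : ℤ) • y) (Sum.inl κ') (Sum.inr μ) * lamCoeffOf (KInv (N := Lc ^ (j + 1)) (d := 3)) (Lc ^ (j + 1)) ν w κ' u)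
            * (straightCount (Lc ^ (j + 1)) ν w f : ℝ) := by
  refine Summable.tsum_finsetSum fun ν _ => summable_of_near (pow_pos (Nat.pos_of_ne_zero (NeZero.ne Lc)) (j + 1)) f.2 fun w hw => ?_
  rw [straightCount_eq_zero_of_not_near ν hw, Int.cast_zero, mul_zero]

/-- [folklore] **(K1) FOR THE COLUMN WITH THE FULLY TRANSPORTED WEIGHT, (0.4)-SYMMETRISED ROWS, EVERY DEPTH**, at any chart with `hA`, `hE`: `α = −(Lc⁴)^{j+1}`. -/
theorem K1_row_A_column_sym (μ : Fin (3 + 1)) (y : Site (3 + 1)) (f : Bond (3 + 1)) :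
    curvAdj (curv (colH A (Lc ^ (j + 1)) μ y)) f.1 f.2
      = -((Lc : ℝ) ^ (3 + 1)) ^ (j + 1) * ∑ κ₁ : Fin (3 + 1), ∑' s₁ : Site (3 + 1),
          (∑ ν : Fin (3 + 1), ∑' w : Site (3 + 1),
              (∑ κ' : Fin (3 + 1), ∑' u : Site (3 + 1),
                  A u (((Lc ^ (j + 1) : ℕ) : ℤ) • y) (Sum.inl κ') (Sum.inr μ) * lamCoeffOf (KInv (N := Lc ^ (j + 1)) (d := 3)) (Lc ^ (j + 1)) ν w κ' u)
                * compLinKer (fun _ => symLinKerAt (toSite R.r) Lc) Lc j (κ₁, s₁) (ν, w))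
            * symLinKerAt (toSite R.r) Lc κ₁ s₁ f := by
  have hLc : (Lc : ℝ) ≠ 0 := Nat.cast_ne_zero.mpr (NeZero.ne Lc)
  rw [K1_row_A_column_straight j A hA hE, tsum_sum_LamA_straightCount_comm,
    show f = (f.1, f.2) from rfl, tsum_lamRA_mul_symLinKerAt_eq_straightCount R j A hA j μ f.1 y f.2, ← mul_assoc, neg_mul, ← mul_pow,
    mul_inv_cancel₀ (pow_ne_zero _ hLc), one_pow, neg_one_mul]

/-- [folklore] **(K1′) AT ANY CHART WITH `hA`, `hE`, `hmm`** (`κ₁ = −1`): the contracted multiplier response is minus the chart's own multiplier–multiplier entry. -/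
theorem LamA_eq_neg_A_inr_inr
    (hmm : ∀ (ν μ : Fin (3 + 1)) (w y : Site (3 + 1)),
      A (((Lc ^ (j + 1) : ℕ) : ℤ) • w) (((Lc ^ (j + 1) : ℕ) : ℤ) • y) (Sum.inr ν) (Sum.inr μ) = wΦ (N := Lc ^ (j + 1)) ν μ (w - y))
    (μ ν : Fin (3 + 1)) (y w : Site (3 + 1)) :
    (∑ κ' : Fin (3 + 1), ∑' u : Site (3 + 1),
        A u (((Lc ^ (j + 1) : ℕ) : ℤ) • y) (Sum.inl κ') (Sum.inr μ) * lamCoeffOf (KInv (N := Lc ^ (j + 1)) (d := 3)) (Lc ^ (j + 1)) ν w κ' u)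
      = -A (((Lc ^ (j + 1) : ℕ) : ℤ) • w) (((Lc ^ (j + 1) : ℕ) : ℤ) • y) (Sum.inr ν) (Sum.inr μ) := by
  rw [LamA_eq_neg_HΦcol j A hA hE, hmm, HΦcol_apply]

end K1Generic


/-! ## §4 (II) CONTROLS at the ROOTED chart `A := AN R j`: the generic §3 at the tree's letters `decays_AN`, `curvAdj_curv_colH_AN`, `AN_inr_inr_smul` IS the tree's PART 22∕28 -/

section Control

example (μ : Fin (3 + 1)) (y : Site (3 + 1)) (f : Bond (3 + 1)) :
    curvAdj (curv (colH (AN R j) (Lc ^ (j + 1)) μ y)) f.1 f.2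
      = -((Lc : ℝ) ^ (3 + 1)) ^ (j + 1) * ∑ κ₁ : Fin (3 + 1), ∑' s₁ : Site (3 + 1),
          (∑ ν : Fin (3 + 1), ∑' w : Site (3 + 1),
              (∑ κ' : Fin (3 + 1), ∑' u : Site (3 + 1),
                  AN R j u (((Lc ^ (j + 1) : ℕ) : ℤ) • y) (Sum.inl κ') (Sum.inr μ) * lamCoeffOf (KInv (N := Lc ^ (j + 1)) (d := 3)) (Lc ^ (j + 1)) ν w κ' u)
                * compLinKer (fun _ => symLinKerAt (toSite R.r) Lc) Lc j (κ₁, s₁) (ν, w))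
            * symLinKerAt (toSite R.r) Lc κ₁ s₁ f :=
  K1_row_A_column_sym R j _ (decays_AN R j) (curvAdj_curv_colH_AN R j) μ y f

/-- (II) CONTROL: the tree's own PART 22 statement (same shape). -/
example (μ : Fin (3 + 1)) (y : Site (3 + 1)) (f : Bond (3 + 1)) :
    curvAdj (curv (colH (AN R j) (Lc ^ (j + 1)) μ y)) f.1 f.2
      = -((Lc : ℝ) ^ (3 + 1)) ^ (j + 1) * ∑ κ₁ : Fin (3 + 1), ∑' s₁ : Site (3 + 1),
          (∑ ν : Fin (3 + 1), ∑' w : Site (3 + 1),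
              (∑ κ' : Fin (3 + 1), ∑' u : Site (3 + 1),
                  AN R j u (((Lc ^ (j + 1) : ℕ) : ℤ) • y) (Sum.inl κ') (Sum.inr μ) * lamCoeffOf (KInv (N := Lc ^ (j + 1)) (d := 3)) (Lc ^ (j + 1)) ν w κ' u)
                * compLinKer (fun _ => symLinKerAt (toSite R.r) Lc) Lc j (κ₁, s₁) (ν, w))
            * symLinKerAt (toSite R.r) Lc κ₁ s₁ f :=
  K1_row_composite_column_sym R j μ y f

example (μ ν : Fin (3 + 1)) (y w : Site (3 + 1)) :
    (∑ κ' : Fin (3 + 1), ∑' u : Site (3 + 1),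
        AN R j u (((Lc ^ (j + 1) : ℕ) : ℤ) • y) (Sum.inl κ') (Sum.inr μ) * lamCoeffOf (KInv (N := Lc ^ (j + 1)) (d := 3)) (Lc ^ (j + 1)) ν w κ' u)
      = -AN R j (((Lc ^ (j + 1) : ℕ) : ℤ) • w) (((Lc ^ (j + 1) : ℕ) : ℤ) • y) (Sum.inr ν) (Sum.inr μ) :=
  LamA_eq_neg_A_inr_inr j _ (decays_AN R j) (curvAdj_curv_colH_AN R j) (AN_inr_inr_smul R j) μ ν y w

/-- (II) CONTROL: the tree's own PART 28 (K1′). -/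
example (μ ν : Fin (3 + 1)) (y w : Site (3 + 1)) :
    (∑ κ' : Fin (3 + 1), ∑' u : Site (3 + 1),
        AN R j u (((Lc ^ (j + 1) : ℕ) : ℤ) • y) (Sum.inl κ') (Sum.inr μ) * lamCoeffOf (KInv (N := Lc ^ (j + 1)) (d := 3)) (Lc ^ (j + 1)) ν w κ' u)
      = -AN R j (((Lc ^ (j + 1) : ℕ) : ℤ) • w) (((Lc ^ (j + 1) : ℕ) : ℤ) • y) (Sum.inr ν) (Sum.inr μ) :=
  LamN_eq_neg_AN_inr_inr R j μ ν y w

end Control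

end

end Summit.QuantumFields.BalabanUV.Beta.NVertexColumnK1RowChartGeneric
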